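import Summits.CriticalPhenomena.PercolationContinuityZ3.Theorems.PercNearOneGluingNoHeavyLowerTailPcovJ1MarkerDT
import Summits.CriticalPhenomena.PercolationContinuityZ3.Theorems.PercNearOneGluingNoHeavyLowerTailCovTauStarBridge
import Summits.CriticalPhenomena.PercolationContinuityZ3.Theorems.PercNearOneGluingNoHeavyLowerTailKnQuestion8StrongFourPoint
import Summits.CriticalPhenomena.PercolationContinuityZ3.Theorems.PercNearOneGluingNoHeavyLowerTailKnQuestion8PocketMarkerPA
import HarnessLib

/-!
# KN Question 8 at `|A| = 3`, covariance side (J1): THEOREM (★₁) — the one-source base — in finitary (`ED`) form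

Support file (`--supports stmt-CriticalPhenomena-4575`, closed crux; independent mathematics on Kozma–Nitzan's Question 8 at
`|A| = 3`), prover `prim-hp-7` (gen 38).  No named facts, no sorries; standard axioms.
Memo `prim-ineq-gen-6/PROOF-STAR1.md` (Theorem (★₁), Steps 2–5) and `FINDING-G14.md` §4; Lean plan (L3) there, first half.

SETTING as in `…PcovJ1MarkerDT.lean` (coordinates `D`, weights `p ∈ [0,1]^D`; owner `x`, observer `o`, marker `v`, source set `M`,
pocket-avoid set `Z ∋ x, v`), with `F` monotone nonnegative on VERTEX sets and `Ψ = liftΨ F x` (so `fcl Ψ x K = F(C_x(K))`,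
`PcovJ1.fcl_liftΨ_eq`).  With
  `e = μ(o ↔ v, x ↮ o, x ↮ v)` (`PcovJ1.eSet`),  `⟨α⟩ = μ(A_ev)` (`PcovJ1.aevSet`),  `⟨h₁⟩ = PcovJ1.h1ED`,
  `A = Cov(F(C_x), 1{x ↔ o}) = CovTauStarN.covOff D p Ψ x o ∅`:

THEOREM (★₁) (`PcovJ1.starOne_ED`):   `e · ⟨h₁⟩ ≤ ⟨α⟩ · A`.
PROOF = the memo's chain: (S5) `⟨h₁⟩ ≤ E F·⟨α⟩ − E[F; A_ev]` (`PcovJ1.markerDT_ED`); the marker-side vdBHK step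
`E[F | A_ev] ≥ E[F | x↮o, x↮v]` (`PocketCert.pocket_marker_pa`, transported to `ED` form: `PcovJ1.pocketMarkerPA_ED`); the observer side
`A ≥ e·(E F − E[F | x↮o, x↮v])` (`PocketCert.strong_fourPoint`, transported: `PcovJ1.strongFourPoint_ED`); linear assembly (dividing by
`μ(x↮o, x↮v)`, the degenerate case being trivial since `e, ⟨α⟩ ≤ μ(x↮o, x↮v)`).  Also: Harris in `ED` form (`PcovJ1.harris_ED`, from the
Gladkov–Zimin diagonal kernel inequality) and the zero-extension of weights (`PcovJ1.exists_weights_ext`, pattern `CovTauStarN.bhk14_ED`).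
[cite: VandenbergHaggstromKahn2005, Thm. 2.1 (p. 9), Thm. 1.4 (p. 7)] [cite: Gladkov2024, Thm. 3.2 (p. 4)] [cite: KozmaNitzan2024, Question 8 (§5.5 p. 36)]
-/

noncomputable section

namespace Summit.CriticalPhenomena.PercolationContinuityZ3.Theorems

namespace PcovJ1

open Finset MeasureTheory Literature.Probability.Percolation Literature.Probability.Percolation.DecisionTree
open Literature.Probability.LatticeModels (prodBernoulli)
open SetClusterExploration TreeHarris CovTauStarN
open scoped Classical

/-! ### Harris in `ED` form; zero-extension of weights -/

section General

variable {ι : Type*} [DecidableEq ι]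

/-- **Harris' inequality in `ED` form**: monotone functions are positively correlated under the weighted cube
(from the Gladkov–Zimin diagonal kernel inequality with the kernel `f(S) g(T)`). [cite: VandenbergHaggstromKahn2005, §1 p. 6] -/
theorem harris_ED (D : Finset ι) {p : ι → ℝ} (hp0 : ∀ i, 0 ≤ p i) (hp1 : ∀ i, p i ≤ 1) {f g : Finset ι → ℝ}
    (hf : Monotone f) (hg : Monotone g) : ED D p f * ED D p g ≤ ED D p (fun K => f K * g K) := by
  have h := ED_ED_le_ED_diag D hp0 hp1 (fun S T => f S * g T) (by
    intro a b c d hab hcd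
    have := mul_nonneg (sub_nonneg.2 (hf hab)) (sub_nonneg.2 (hg hcd))
    nlinarith [this])
  have e1 : (fun S => ED D p (fun T => f S * g T)) = fun S => ED D p g * f S := by
    funext S; rw [ED_mul_left]; ring
  rw [e1, ED_mul_left] at h
  linarith [h]

/-- Weights `p` on `D` extended by zero to all coordinates, as `unitInterval`-valued weights (pattern `CovTauStarN.bhk14_ED`).
[folklore] -/
theorem exists_weights_ext (D : Finset ι) {p : ι → ℝ} (hp0 : ∀ i, 0 ≤ p i) (hp1 : ∀ i, p i ≤ 1) :
    ∃ w : ι → unitInterval, (∀ i ∈ D, ((w i : unitInterval) : ℝ) = p i) ∧ (∀ i ∉ D, ((w i : unitInterval) : ℝ) = 0) := by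
  refine ⟨fun i => if i ∈ D then ⟨max 0 (min 1 (p i)), by
    exact ⟨le_max_left _ _, max_le zero_le_one (min_le_left _ _)⟩⟩ else 0, fun i hi => ?_, fun i hi => ?_⟩
  · simp only [if_pos hi]
    rw [min_eq_right (hp1 i), max_eq_right (hp0 i)]
  · simp only [if_neg hi]; rfl

end General

/-! ### The vertex-cluster functional and the events, read on finite configurations -/

variable {V : Type*} [Fintype V] [DecidableEq V]

omit [Fintype V] [DecidableEq V] in
/-- `fcl (liftΨ F x) x K = F(C_x(K))` with `C_x` the VERTEX cluster (`openCluster`). [folklore] -/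
theorem fcl_liftΨ_eq (F : Set V → ℝ) (x : V) (K : Finset (Sym2 V)) :
    fcl (liftΨ F x) x K = F (openCluster (↑K : Set (Sym2 V)) x) := by
  unfold fcl liftΨ openCluster
  congr 1
  ext u
  simp only [Set.mem_union, Set.mem_singleton_iff, Set.mem_setOf_eq, reachable_iff_exists_mem_openEdgeCluster]

/-- The event `{x ↮ o} ∩ {x ↮ v} ∩ {o ↔ v}` (its probability is the functional `e = ⟨e⟩_∅` of the J1 route). [folklore] -/
def eSet (x o v : V) : Set (Finset (Sym2 V)) :=
  {L | ¬ (openGraph (↑L : Set (Sym2 V))).Reachable x o ∧ ¬ (openGraph (↑L : Set (Sym2 V))).Reachable x v ∧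
    (openGraph (↑L : Set (Sym2 V))).Reachable o v}

/-- The event `N_T = {x ↮ o} ∩ {x ↮ v}`. [folklore] -/
def ntSet (x o v : V) : Set (Finset (Sym2 V)) :=
  {L | ¬ (openGraph (↑L : Set (Sym2 V))).Reachable x o ∧ ¬ (openGraph (↑L : Set (Sym2 V))).Reachable x v}

omit [Fintype V] [DecidableEq V] in
/-- For `x, v ∈ Z` the avoidance event is `N_T ∩ {v ↮ M} ∩ {o ↮ v} ∩ {o ↮ Z}` (the shape of `PocketCert.pocket_marker_pa`). [folklore] -/
theorem mem_aevSet_iff {x o v : V} {M Z : Finset V} (hxZ : x ∈ Z) (hvZ : v ∈ Z) (K : Finset (Sym2 V)) :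
    K ∈ aevSet x o v M Z ↔
      (↑K : Set (Sym2 V)) ∈ ({ω : BondConfig V | ¬ (openGraph ω).Reachable x o} ∩ {ω | ¬ (openGraph ω).Reachable x v}) ∩
        ({ω | ∀ n ∈ (↑M : Set V), ¬ (openGraph ω).Reachable v n} ∩ {ω | ¬ (openGraph ω).Reachable o v} ∩
          {ω | ∀ z ∈ (↑Z : Set V), ¬ (openGraph ω).Reachable o z}) := by
  simp only [aevSet, Set.mem_setOf_eq, Set.mem_inter_iff, Finset.mem_coe]
  constructor
  · rintro ⟨h1, h2, h3⟩
    exact ⟨⟨fun h => h3 x hxZ h.symm, h1⟩, ⟨fun n hn h => h2 n hn h.symm, h3 v hvZ⟩, h3⟩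
  · rintro ⟨⟨-, h1⟩, ⟨h2, -⟩, h3⟩
    exact ⟨h1, fun s hs h => h2 s hs h.symm, h3⟩

/-! ### The two measure-level inputs in `ED` form -/

/-- **`PocketCert.strong_fourPoint` in `ED` form**: `e · (μ(N_T)·E F − E[F; N_T]) ≤ μ(N_T) · Cov(F(C_x), 1{x↔o})`.
[cite: VandenbergHaggstromKahn2005, Thm. 2.1 (p. 9), §1 p. 6] -/
theorem strongFourPoint_ED (D : Finset (Sym2 V)) {p : Sym2 V → ℝ} (hp0 : ∀ e, 0 ≤ p e) (hp1 : ∀ e, p e ≤ 1)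
    (F : Set V → ℝ) (hF : ∀ S T : Set V, S ⊆ T → F S ≤ F T) (hF0 : ∀ S, 0 ≤ F S) (x o v : V) :
    ED D p (ind (eSet x o v)) *
        (ED D p (ind (ntSet x o v)) * ED D p (fcl (liftΨ F x) x) -
          ED D p (fun K => fcl (liftΨ F x) x K * ind (ntSet x o v) K)) ≤
      ED D p (ind (ntSet x o v)) * covOff D p (liftΨ F x) x o ∅ := by
  obtain ⟨w, hwD, hwD'⟩ := exists_weights_ext D hp0 hp1
  have hED : ∀ φ : Finset (Sym2 V) → ℝ, ED Finset.univ (fun e => (w e : ℝ)) φ = ED D p φ :=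
    fun φ => ED_univ_eq_ED_of_zero D p _ hwD hwD' φ
  have key := PocketCert.strong_fourPoint w o x v F hF hF0
  rw [measureReal_eq_ED, measureReal_eq_ED, measureReal_eq_ED, setIntegral_eq_ED, setIntegral_eq_ED, integral_eq_ED] at key
  simp only [hED] at key
  -- identify the integrands
  have eE : ED D p (fun K => ind (({ω : BondConfig V | ¬ (openGraph ω).Reachable x o} ∩
      {ω | ¬ (openGraph ω).Reachable x v}) ∩ openConn o v) (↑K : Set (Sym2 V))) = ED D p (ind (eSet x o v)) :=
    ED_congr_on D p fun K _ => BystanderBHK.ind_congr (by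
      simp only [eSet, openConn, Set.mem_inter_iff, Set.mem_setOf_eq, and_assoc])
  have eT : ED D p (fun K => ind ({ω : BondConfig V | ¬ (openGraph ω).Reachable x o} ∩
      {ω | ¬ (openGraph ω).Reachable x v}) (↑K : Set (Sym2 V))) = ED D p (ind (ntSet x o v)) :=
    ED_congr_on D p fun K _ => BystanderBHK.ind_congr (by
      simp only [ntSet, Set.mem_inter_iff, Set.mem_setOf_eq])
  have eF : ED D p (fun K => F (openCluster (↑K : Set (Sym2 V)) x)) = ED D p (fcl (liftΨ F x) x) :=
    ED_congr_on D p fun K _ => by rw [fcl_liftΨ_eq]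
  have eFT : ED D p (fun K => ind ({ω : BondConfig V | ¬ (openGraph ω).Reachable x o} ∩
      {ω | ¬ (openGraph ω).Reachable x v}) (↑K : Set (Sym2 V)) * F (openCluster (↑K : Set (Sym2 V)) x)) =
      ED D p (fun K => fcl (liftΨ F x) x K * ind (ntSet x o v) K) :=
    ED_congr_on D p fun K _ => by rw [fcl_liftΨ_eq, mul_comm]; rfl
  have eO : ED D p (fun K => ind (openConn x o) (↑K : Set (Sym2 V))) = ED D p (hr x o) :=
    ED_congr_on D p fun K _ => BystanderBHK.ind_congr (by simp only [openConn, Set.mem_setOf_eq])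
  have eFO : ED D p (fun K => ind (openConn x o) (↑K : Set (Sym2 V)) * F (openCluster (↑K : Set (Sym2 V)) x)) =
      ED D p (fun K => fcl (liftΨ F x) x K * hr x o K) :=
    ED_congr_on D p fun K _ => by rw [fcl_liftΨ_eq, mul_comm]; rfl
  rw [eE, eT, eF, eFT, eO, eFO] at key
  have hA : covOff D p (liftΨ F x) x o ∅ =
      ED D p (fun K => fcl (liftΨ F x) x K * hr x o K) - ED D p (fcl (liftΨ F x) x) * ED D p (hr x o) := by
    simp only [covOff, off_empty]
  rw [hA]
  linarith [key]

/-- **`PocketCert.pocket_marker_pa` in `ED` form**: `E[F; N_T] · ⟨α⟩ ≤ μ(N_T) · E[F; A_ev]` for `x, v ∈ Z`.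
[cite: VandenbergHaggstromKahn2005, Thm. 2.1 (p. 9)] -/
theorem pocketMarkerPA_ED (D : Finset (Sym2 V)) {p : Sym2 V → ℝ} (hp0 : ∀ e, 0 ≤ p e) (hp1 : ∀ e, p e ≤ 1)
    (F : Set V → ℝ) (hF : ∀ S T : Set V, S ⊆ T → F S ≤ F T) (x o v : V) (M Z : Finset V) (hxZ : x ∈ Z)
    (hvZ : v ∈ Z) :
    ED D p (fun K => fcl (liftΨ F x) x K * ind (ntSet x o v) K) * ED D p (ind (aevSet x o v M Z)) ≤
      ED D p (ind (ntSet x o v)) * ED D p (fun K => fcl (liftΨ F x) x K * ind (aevSet x o v M Z) K) := by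
  obtain ⟨w, hwD, hwD'⟩ := exists_weights_ext D hp0 hp1
  have hED : ∀ φ : Finset (Sym2 V) → ℝ, ED Finset.univ (fun e => (w e : ℝ)) φ = ED D p φ :=
    fun φ => ED_univ_eq_ED_of_zero D p _ hwD hwD' φ
  have key := PocketCert.pocket_marker_pa w o x v (↑M : Set V) (↑Z : Set V) F hF
  rw [measureReal_eq_ED, measureReal_eq_ED, setIntegral_eq_ED, setIntegral_eq_ED] at key
  simp only [hED] at key
  have eT : ED D p (fun K => ind ({ω : BondConfig V | ¬ (openGraph ω).Reachable x o} ∩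
      {ω | ¬ (openGraph ω).Reachable x v}) (↑K : Set (Sym2 V))) = ED D p (ind (ntSet x o v)) :=
    ED_congr_on D p fun K _ => BystanderBHK.ind_congr (by
      simp only [ntSet, Set.mem_inter_iff, Set.mem_setOf_eq])
  have eFT : ED D p (fun K => ind ({ω : BondConfig V | ¬ (openGraph ω).Reachable x o} ∩
      {ω | ¬ (openGraph ω).Reachable x v}) (↑K : Set (Sym2 V)) * F (openCluster (↑K : Set (Sym2 V)) x)) =
      ED D p (fun K => fcl (liftΨ F x) x K * ind (ntSet x o v) K) :=
    ED_congr_on D p fun K _ => by rw [fcl_liftΨ_eq, mul_comm]; rfl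
  have eA : ED D p (fun K => ind (({ω : BondConfig V | ¬ (openGraph ω).Reachable x o} ∩
      {ω | ¬ (openGraph ω).Reachable x v}) ∩
        ({ω | ∀ n ∈ (↑M : Set V), ¬ (openGraph ω).Reachable v n} ∩ {ω | ¬ (openGraph ω).Reachable o v} ∩
          {ω | ∀ z ∈ (↑Z : Set V), ¬ (openGraph ω).Reachable o z})) (↑K : Set (Sym2 V))) =
      ED D p (ind (aevSet x o v M Z)) :=
    ED_congr_on D p fun K _ => BystanderBHK.ind_congr (mem_aevSet_iff hxZ hvZ K).symm
  have eFA : ED D p (fun K => ind (({ω : BondConfig V | ¬ (openGraph ω).Reachable x o} ∩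
      {ω | ¬ (openGraph ω).Reachable x v}) ∩
        ({ω | ∀ n ∈ (↑M : Set V), ¬ (openGraph ω).Reachable v n} ∩ {ω | ¬ (openGraph ω).Reachable o v} ∩
          {ω | ∀ z ∈ (↑Z : Set V), ¬ (openGraph ω).Reachable o z})) (↑K : Set (Sym2 V)) *
        F (openCluster (↑K : Set (Sym2 V)) x)) =
      ED D p (fun K => fcl (liftΨ F x) x K * ind (aevSet x o v M Z) K) :=
    ED_congr_on D p fun K _ => by
      rw [fcl_liftΨ_eq, mul_comm]
      congr 1
      exact BystanderBHK.ind_congr (mem_aevSet_iff hxZ hvZ K).symm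
  rw [eT, eFT, eA, eFA] at key
  exact key

/-! ### (★₁) -/

/-- **THEOREM (★₁)** (prim-ineq-gen-6, PROOF-STAR1.md §1–§2): for `x, v ∈ Z` and `F` monotone nonnegative on vertex sets,
`μ(o↔v, x↮o, x↮v) · ⟨h₁⟩ ≤ μ(A_ev) · Cov(F(C_x), 1{x↔o})`.
[cite: VandenbergHaggstromKahn2005, Thm. 2.1 (p. 9), Thm. 1.4 (p. 7)] [cite: Gladkov2024, Thm. 3.2 (p. 4)]
[cite: KozmaNitzan2024, Question 8 (§5.5 p. 36)] -/
theorem starOne_ED (D : Finset (Sym2 V)) {p : Sym2 V → ℝ} (hp0 : ∀ e, 0 ≤ p e) (hp1 : ∀ e, p e ≤ 1)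
    (F : Set V → ℝ) (hF : ∀ S T : Set V, S ⊆ T → F S ≤ F T) (hF0 : ∀ S, 0 ≤ F S) (x o v : V) (M Z : Finset V)
    (hxZ : x ∈ Z) (hvZ : v ∈ Z) :
    ED D p (ind (eSet x o v)) * h1ED D p (liftΨ F x) x o v M Z ≤
      ED D p (ind (aevSet x o v M Z)) * covOff D p (liftΨ F x) x o ∅ := by
  have hS5 := markerDT_ED D hp0 hp1 (liftΨ F x) (liftΨ_mono hF x) (fun C => hF0 _) x o v M Z hxZ
  have hPA := pocketMarkerPA_ED D hp0 hp1 F hF x o v M Z hxZ hvZ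
  have h4 := strongFourPoint_ED D hp0 hp1 F hF hF0 x o v
  -- names
  set e := ED D p (ind (eSet x o v)) with he
  set P0 := ED D p (ind (ntSet x o v)) with hP0
  set m := ED D p (fcl (liftΨ F x) x) with hm
  set IT := ED D p (fun K => fcl (liftΨ F x) x K * ind (ntSet x o v) K) with hIT
  set α := ED D p (ind (aevSet x o v M Z)) with hα
  set IA := ED D p (fun K => fcl (liftΨ F x) x K * ind (aevSet x o v M Z) K) with hIA
  set A := covOff D p (liftΨ F x) x o ∅ with hA
  set H := h1ED D p (liftΨ F x) x o v M Z with hH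
  -- signs and the inclusions `eSet, aevSet ⊆ ntSet`
  have he0 : 0 ≤ e := Finset.sum_nonneg fun K _ => mul_nonneg (wtW_nonneg D hp0 hp1 K) (ind_nonneg _ _)
  have hα0 : 0 ≤ α := Finset.sum_nonneg fun K _ => mul_nonneg (wtW_nonneg D hp0 hp1 K) (ind_nonneg _ _)
  have hIA0 : 0 ≤ IA :=
    Finset.sum_nonneg fun K _ => mul_nonneg (wtW_nonneg D hp0 hp1 K) (mul_nonneg (hF0 _) (ind_nonneg _ _))
  have heP : e ≤ P0 := ED_mono D hp0 hp1 fun K _ =>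
    BHK2006.ind_mono (fun L (hL : L ∈ eSet x o v) => show L ∈ ntSet x o v from ⟨hL.1, hL.2.1⟩) K
  have hαP : α ≤ P0 := ED_mono D hp0 hp1 fun K _ =>
    BHK2006.ind_mono (fun L (hL : L ∈ aevSet x o v M Z) =>
      show L ∈ ntSet x o v from ⟨fun h => hL.2.2 x hxZ h.symm, hL.1⟩) K
  rcases (le_trans he0 heP).eq_or_lt with hP | hP
  · -- `μ(N_T) = 0`: everything vanishes
    have he' : e = 0 := le_antisymm (hP ▸ heP) he0
    have hα' : α = 0 := le_antisymm (hP ▸ hαP) hα0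
    rw [he', hα', zero_mul, zero_mul]
  · -- `μ(N_T) > 0`: divide
    have h1 : P0 * (e * H) ≤ P0 * (e * (m * α - IA)) :=
      mul_le_mul_of_nonneg_left (mul_le_mul_of_nonneg_left hS5 he0) hP.le
    have h2 : e * (P0 * (m * α - IA)) ≤ e * (α * (P0 * m - IT)) := by
      refine mul_le_mul_of_nonneg_left ?_ he0
      nlinarith [hPA]
    have h3 : α * (e * (P0 * m - IT)) ≤ α * (P0 * A) := mul_le_mul_of_nonneg_left h4 hα0
    have key : P0 * (e * H) ≤ P0 * (α * A) := by nlinarith [h1, h2, h3]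
    exact le_of_mul_le_mul_left key hP

end PcovJ1

end Summit.CriticalPhenomena.PercolationContinuityZ3.Theorems

end
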